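import Summits.HodgeConjecture.HodgeConjecture.Theorems.Ring2AbelianAllAndreDecomposableRestrictions
import Summits.HodgeConjecture.HodgeConjecture.Theorems.Ring2AbelianAllAndreFibreClassAlgebraicInvariants
import Summits.HodgeConjecture.HodgeConjecture.Theorems.Ring2AbelianAllAndreNumericalLift
import Summits.HodgeConjecture.HodgeConjecture.Theorems.Ring2AbelianAllAndreInvariantLiftsIdempotent
import Literature.AlgebraicGeometry.HodgeTheory.AlgebraicClassesExteriorProduct
import HarnessLib

/-!
# Ring 2 · sub-cell AbelianAll (ALL ABELIAN VARIETIES), André axis, part XLIV-g — DECOMPOSABLE WITNESSES ⟺ `(N_p)(t)`: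
# the converse of part XLIV-d — from `(N_p)(t) ∧ (N_{d−p})(t)` an EXPLICIT decomposable class `Σᵢ pr_1^* Dᵢ ∪ pr_2^* Aᵢ` of `𝒳 × 𝒳`
# (algebraic `Dᵢ, Aᵢ`, dual bases of the invariants under the fibre pairing) RESTRICTS on `X_t × X_t` to the identity of `j_t^* H^{2p}(𝒳)`

HONEST FRAMING (page 1, verbatim): **research route, not a corollary; conditional on HC_CM plus one named
minimal statement.** Cell line: research route conditional on HC_CM; not a corollary; Q11.4-sentence-2
already refuted in dim ≥ 3. Nothing in this file proves a case of the Hodge conjecture or of `B`; `HC_CM` does NOT occur; item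
`Theses.RankFourFaces.CMToAbelian` (stmt-16267) stays OPEN; N104 untouched; no node is born (0 `def`). Seat `pub-hodge-ring2-ab-andre-2`,
gen 36; closes the owed item (o137) of parts XLIV-d/f (the converse of the dichotomy, in EXPOSED form).

## Content (sorry-free, standard axioms; no named fact)

Part XLIV-d: a DECOMPOSABLE class (span `𝐃` of exterior products of algebraic classes of `𝒳`) restricting to the identity on `I_t^{2p} = j_t^* H^{2p}(𝒳)`
forces `(N_p)(t)`. Part XIV-e (`fibreClassLefschetz_deg_of_algebraicInvariants`) proved the converse rung «`(N_p)(t) ∧ (N_{d−p})(t) ⟹ β`» with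
the cycle `Σᵢ Dᵢ × Aᵢ` hidden behind an existential. THIS FILE exposes it on the FIBRE, without the fibre trace and without any scalar:

* §1 `decomposable_le_algebraicClasses` — `𝐃 ≤ N^d H^{2d}((𝒳 × 𝒳)(ℂ))` (exterior products of algebraic classes are algebraic, tree theorem).
* §2 **`exists_decomposable_restrict_acts_as_id_of_algebraicInvariantClassesAt`** — `(N_p)(t) ∧ (N_q)(t)`, `p + q = d` ⟹ there is
  `γ = Σᵢ pr_1^* Dᵢ ∪ pr_2^* Aᵢ ∈ 𝐃`, `Dᵢ ∈ N^p(𝒳)`, `Aᵢ ∈ N^q(𝒳)`, whose RESTRICTION `(j_t × j_t)^* γ` acts as the identity on `I_t^{2p}`.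
  Proof: the fibre pairing `B(A, W) = ε(pr_{1*} pr_2^*(j_t^* W ∪ j_t^* A))` on `H^{2q}(𝒳) × H^{2p}(𝒳)` kills `ker j_t^*` on both sides and is
  non-degenerate modulo these kernels (Poincaré duality on `X_t` in the form `j_{t*} b = 0 ⟺ j_t^* W ∪ b = 0 ∀ W`, part XXX, and
  `Im j_t^* ∩ ker j_{t*} = 0`, part XXVI-a); part XIV-e §1 (`exists_reproducing_pairs_of_perfect`) gives algebraic dual families
  `j_t^*(Σᵢ B(Aᵢ, W) Dᵢ) = j_t^* W`; and the restricted generator `pr_1^* j_t^* Dᵢ ∪ pr_2^* j_t^* Aᵢ` acts as `x ↦ ε(pr_{1*} pr_2^*(x ∪ j_t^* Aᵢ)) · j_t^* Dᵢ`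
  (part XXII `corrAction_cross_signed`, `cupProduct_degZero_right`).
* §3 **`exists_decomposable_restrict_acts_as_id_iff_algebraicInvariantClassesAt`** — for `2p ≤ d`: **a decomposable class of `𝒳 × 𝒳` restricting to
  the identity of `I_t^{2p}` EXISTS iff `(N_p)(t)`** (⟸ §2 with `(N_{d−p})(t)` from `(N_p)(t)` by part XV's hard-Lefschetz transfer
  `algebraicInvariantClassesAt_compl_of_le`; ⟹ part XLIV-d). With part XLIV-b §3 (`𝐃 ≤ N^d`): the member-side rows are EXACTLY the decomposable
  β-witnesses — the dichotomy of part XLIV-d is an equivalence.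

## Honest status

Bookkeeping equivalence; no new case of anything. Nothing minimal is claimed; N104 untouched. EDGE LABELS: all K (no binder); §3 concludes / consumes
the EXISTING node `AlgebraicInvariantClassesAt` by name. References: Kleiman1968AlgebraicCycles (§1.3, 2A11); Abdulali1994FamiliesAV (Conj. 5.3, Thm. 5.5);
VoisinHodgeII2003 (proof of Thm. 10.17 (10.7), Prop. 9.20); HatcherAT2002 (Prop. 3.38, Thm. 3.15); DeligneHodgeII1971 (Thm. 4.1.1); Fulton1998 (§16.1).
-/

noncomputable section

set_option linter.dupNamespace false

namespace Summit.HodgeConjecture.HodgeConjecture.Ring2.AbelianAll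

open CategoryTheory CategoryTheory.Limits AlgebraicGeometry MonoidalCategory CartesianMonoidalCategory
open Literature.AlgebraicGeometry Literature.AlgebraicGeometry.Motives
open Literature.AlgebraicGeometry.HodgeTheory
open Literature.AlgebraicTopology.SingularHomology (singularCohomology cupProduct cupProduct_map cupProduct_gradedComm_holds
  singularCohomologyZeroEquiv)
open Summit.HodgeConjecture.HodgeConjecture.Theorems (deg_fiberGysin_aux)

variable {𝒳 S : SchemeOver ℂ} {d : ℕ} {f : 𝒳 ⟶ S} (hf : IsCompactAbelianPencil f d)

/-- `𝐣[s, k]` — `j_s^* : Hᵏ(𝒳(ℂ); ℂ) → Hᵏ(X_s(ℂ); ℂ)` as a linear map (display notation). [cite: VoisinHodgeI2002, §7.3.2] -/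
local notation3 (prettyPrint := false) "𝐣[" s ", " k "]" => (complexBetti.map (fiberι f s) k).hom

/-- `𝐑[hf, t, k]` — the action on `Hᵏ(X_t(ℂ); ℂ)` of a codimension-`d` class of `X_t × X_t`, complex orientations (display notation, as in part XLIV-b).
[cite: VoisinHodgeII2003, proof of Thm. 10.17 (10.7)] -/
local notation3 (prettyPrint := false) "𝐑[" hf ", " t ", " k "]" =>
  corrAction complexOrientationFamily (IsCompactAbelianPencil.isSmoothProjective_fiberOver hf t)
    (IsCompactAbelianPencil.isSmoothProjective_fiberOver hf t) (rfl : k + 2 * d = k + 2 * d)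

/-- `𝐃[𝒳, d]` — the DECOMPOSABLE ALGEBRAIC classes of `𝒳 × 𝒳` in degree `2d` (display notation, as in part XLIV-d). [cite: Kleiman1968AlgebraicCycles, §1.3] -/
local notation3 (prettyPrint := false) "𝐃[" 𝒳 ", " d "]" =>
  Submodule.span ℂ {v : complexBetti (𝒳 ⊗ 𝒳) (2 * d) | ∃ (p₁ p₂ : ℕ) (h : 2 * p₁ + 2 * p₂ = 2 * d)
    (a : complexBetti 𝒳 (2 * p₁)) (b : complexBetti 𝒳 (2 * p₂)), a ∈ algebraicClasses 𝒳 p₁ ∧ b ∈ algebraicClasses 𝒳 p₂ ∧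
      v = cupProduct h (complexBetti.map (fst 𝒳 𝒳) (2 * p₁) a) (complexBetti.map (snd 𝒳 𝒳) (2 * p₂) b)}

/-! ## §1 Decomposable classes are algebraic -/

include hf in
/-- **`𝐃 ≤ N^d H^{2d}((𝒳 × 𝒳)(ℂ))`**: exterior products of algebraic classes are algebraic (the tree's
`cupProduct_map_fst_map_snd_mem_algebraicClasses`, Voisin II proof of Prop. 9.20 — products of subvarieties, no moving lemma).
[cite: VoisinHodgeII2003, §9.2.4 proof of Prop. 9.20] [cite: Kleiman1968AlgebraicCycles, §1.3] -/
theorem decomposable_le_algebraicClasses : 𝐃[𝒳, d] ≤ algebraicClasses (𝒳 ⊗ 𝒳) d := by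
  have hX := hf.isSmoothProjective_total
  refine Submodule.span_le.2 ?_
  rintro v ⟨p₁, p₂, h, a, b, ha, hb, rfl⟩
  obtain rfl : d = p₁ + p₂ := by omega
  exact cupProduct_map_fst_map_snd_mem_algebraicClasses hX hX ha hb

/-! ## §2 From `(N_p)(t) ∧ (N_q)(t)` to an explicit decomposable class restricting to the identity of the invariants -/

/-- **`(N_p)(t) ∧ (N_{d−p})(t) ⟹` A DECOMPOSABLE CLASS OF `𝒳 × 𝒳` RESTRICTS ON `X_t × X_t` TO THE IDENTITY OF `j_t^* H^{2p}(𝒳)`** (the converse of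
part XLIV-d, exposed; `p + q = d`). There are algebraic `Dᵢ ∈ N^p(𝒳)`, `Aᵢ ∈ N^q(𝒳)` — dual families of the invariants under the fibre pairing
`ε(pr_{1*} pr_2^*(j_t^* W ∪ j_t^* A))` (part XIV-e §1 `exists_reproducing_pairs_of_perfect`; the pairing kills `ker j_t^*` twice and is
non-degenerate modulo it by Poincaré duality on `X_t` + `Im j_t^* ∩ ker j_{t*} = 0`) — such that `γ = Σᵢ pr_1^* Dᵢ ∪ pr_2^* Aᵢ ∈ 𝐃` satisfies
`[(j_t × j_t)^* γ]_* (j_t^* W) = j_t^* W` for every `W`. [cite: Abdulali1994FamiliesAV, Conjecture 5.3 and Theorem 5.5 (p. 1130)]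
[cite: VoisinHodgeII2003, proof of Thm. 10.17 (10.7)] [cite: HatcherAT2002, §3.3 Prop. 3.38] [cite: DeligneHodgeII1971, Thm. 4.1.1] -/
theorem exists_decomposable_restrict_acts_as_id_of_algebraicInvariantClassesAt (t : ComplexPoints S) {p q : ℕ} (hpq : p + q = d)
    (hNp : AlgebraicInvariantClassesAt hf t p) (hNq : AlgebraicInvariantClassesAt hf t q) :
    ∃ γ ∈ 𝐃[𝒳, d], ∀ W : complexBetti 𝒳 (2 * p),
      𝐑[hf, t, 2 * p] (complexBetti.map (fiberι f t ⊗ₘ fiberι f t) (2 * d) γ) (𝐣[t, 2 * p] W) = 𝐣[t, 2 * p] W := by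
  have hX := hf.isSmoothProjective_total
  have hXt := hf.isSmoothProjective_fiberOver t
  have hXtXt := hXt.tensor_holds hXt
  haveI : Module.Finite ℂ (complexBetti 𝒳 (2 * p)) := finite_complexBetti hX _
  haveI : Module.Finite ℂ (complexBetti 𝒳 (2 * q)) := finite_complexBetti hX _
  haveI := pathConnectedSpace_complexPoints hXt
  set j := fiberι f t with hj
  have h2 : 2 * p + 2 * q = 2 * d := by omega
  -- the fibre functional `λ z = ε(pr_{1*} pr_2^* z)` on `H^{2d}(X_t)`, injective on the top line
  let lam : complexBetti (fiberOver f t) (2 * d) →ₗ[ℂ] ℂ :=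
    (singularCohomologyZeroEquiv ℂ ℂ (ComplexPoints (fiberOver f t))).toLinearMap ∘ₗ
      (complexGysin complexOrientationFamily hXtXt hXt (fst (fiberOver f t) (fiberOver f t))
        (show 2 * d + 2 * d = 0 + 2 * (d + d) by omega)) ∘ₗ
        (complexBetti.map (snd (fiberOver f t) (fiberOver f t)) (2 * d)).hom
  have hlam : ∀ z, lam z = singularCohomologyZeroEquiv ℂ ℂ (ComplexPoints (fiberOver f t))
      (complexGysin complexOrientationFamily hXtXt hXt (fst (fiberOver f t) (fiberOver f t))
        (show 2 * d + 2 * d = 0 + 2 * (d + d) by omega)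
        (complexBetti.map (snd (fiberOver f t) (fiberOver f t)) (2 * d) z)) := fun _ ↦ rfl
  have hlam0 : ∀ z, lam z = 0 → z = 0 := fun z hz ↦ by
    by_contra hz0
    refine complexGysin_fst_map_snd_ne_zero complexOrientationFamily hXt hXt hz0 ?_
    rw [Literature.AlgebraicTopology.SingularHomology.singularCohomology.eq_smul_one ℂ
      (complexGysin complexOrientationFamily hXtXt hXt (fst (fiberOver f t) (fiberOver f t)) _
        (complexBetti.map (snd (fiberOver f t) (fiberOver f t)) (2 * d) z)), ← hlam, hz, zero_smul]
  -- the pairing `B(A, W) = λ(j^* W ∪ j^* A)`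
  set j₁ : complexBetti 𝒳 (2 * p) →ₗ[ℂ] complexBetti (fiberOver f t) (2 * p) := 𝐣[t, 2 * p] with hj₁
  set j₂ : complexBetti 𝒳 (2 * q) →ₗ[ℂ] complexBetti (fiberOver f t) (2 * q) := 𝐣[t, 2 * q] with hj₂
  set B : complexBetti 𝒳 (2 * q) →ₗ[ℂ] complexBetti 𝒳 (2 * p) →ₗ[ℂ] ℂ :=
    (((cupProduct h2).compl₁₂ j₁ j₂).compr₂ lam).flip with hB
  have hBapply : ∀ A W, B A W = lam (cupProduct h2 (j₁ W) (j₂ A)) := fun _ _ ↦ rfl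
  -- the four hypotheses of part XIV-e §1
  have hB₁ : ∀ A, j₂ A = 0 → ∀ W, B A W = 0 := fun A hA W ↦ by
    rw [hBapply, hA, map_zero, map_zero]
  have hB₂ : ∀ W, j₁ W = 0 → ∀ A, B A W = 0 := fun W hW A ↦ by
    rw [hBapply, hW, map_zero, LinearMap.zero_apply, map_zero]
  have hB₃ : ∀ A, (∀ W, B A W = 0) → j₂ A = 0 := fun A hA ↦ by
    have h1 : ∀ W : complexBetti 𝒳 (2 * p), cupProduct h2 (j₁ W) (j₂ A) = 0 := fun W ↦
      hlam0 _ (by rw [← hBapply]; exact hA W)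
    have hG : fiberGysin hf t q (j₂ A) = 0 := (fiberGysin_eq_zero_iff_forall_cupProduct hf t hpq (j₂ A)).2 h1
    have hc := isCompl_range_map_fiberι_ker_complexGysin hf.isSmoothProjective_base hf.isSmoothProjectiveFamily hX
      (show 2 * q + 2 * (d + 1) = 2 * (q + 1) + 2 * d by omega) t
    exact (Submodule.disjoint_def.1 hc.disjoint) _ (LinearMap.mem_range_self _ A) (LinearMap.mem_ker.2 hG)
  have hB₄ : ∀ W, (∀ A, B A W = 0) → j₁ W = 0 := fun W hW ↦ by
    have h1 : ∀ A : complexBetti 𝒳 (2 * q), cupProduct (show 2 * q + 2 * p = 2 * d by omega) (j₂ A) (j₁ W) = 0 := fun A ↦ by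
      rw [cupProduct_gradedComm_holds ℂ _ (show 2 * q + 2 * p = 2 * d by omega) h2 (j₂ A) (j₁ W),
        hlam0 (cupProduct h2 (j₁ W) (j₂ A)) (by rw [← hBapply]; exact hW A), smul_zero]
    have hG : fiberGysin hf t p (j₁ W) = 0 :=
      (fiberGysin_eq_zero_iff_forall_cupProduct hf t (show q + p = d by omega) (j₁ W)).2 h1
    have hc := isCompl_range_map_fiberι_ker_complexGysin hf.isSmoothProjective_base hf.isSmoothProjectiveFamily hX
      (show 2 * p + 2 * (d + 1) = 2 * (p + 1) + 2 * d by omega) t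
    exact (Submodule.disjoint_def.1 hc.disjoint) _ (LinearMap.mem_range_self _ W) (LinearMap.mem_ker.2 hG)
  -- dual families of algebraic classes
  obtain ⟨r, A, D, hA, hD, hrep⟩ := exists_reproducing_pairs_of_perfect j₁ j₂ (algebraicClasses 𝒳 p)
    (algebraicClasses 𝒳 q) (fun W ↦ hNp W) (fun A' ↦ hNq A') B hB₁ hB₂ hB₃ hB₄
  -- the decomposable class
  refine ⟨∑ i, cupProduct h2 (complexBetti.map (fst 𝒳 𝒳) (2 * p) (D i)) (complexBetti.map (snd 𝒳 𝒳) (2 * q) (A i)),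
    Submodule.sum_mem _ fun i _ ↦ Submodule.subset_span ⟨p, q, h2, D i, A i, hD i, hA i, rfl⟩, fun W ↦ ?_⟩
  -- restriction of the generators
  have e₁ : ∀ i, complexBetti.map (j ⊗ₘ j) (2 * p) (complexBetti.map (fst 𝒳 𝒳) (2 * p) (D i)) =
      complexBetti.map (fst (fiberOver f t) (fiberOver f t)) (2 * p) (j₁ (D i)) := fun i ↦ by
    rw [← CategoryTheory.comp_apply, ← complexBetti.map_comp, tensorHom_fst, complexBetti.map_comp, CategoryTheory.comp_apply]
  have e₂ : ∀ i, complexBetti.map (j ⊗ₘ j) (2 * q) (complexBetti.map (snd 𝒳 𝒳) (2 * q) (A i)) =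
      complexBetti.map (snd (fiberOver f t) (fiberOver f t)) (2 * q) (j₂ (A i)) := fun i ↦ by
    rw [← CategoryTheory.comp_apply, ← complexBetti.map_comp, tensorHom_snd, complexBetti.map_comp, CategoryTheory.comp_apply]
  rw [map_sum, map_sum, LinearMap.sum_apply]
  have hterm : ∀ i, 𝐑[hf, t, 2 * p] (complexBetti.map (j ⊗ₘ j) (2 * d)
      (cupProduct h2 (complexBetti.map (fst 𝒳 𝒳) (2 * p) (D i)) (complexBetti.map (snd 𝒳 𝒳) (2 * q) (A i)))) (j₁ W) =
      B (A i) W • j₁ (D i) := fun i ↦ by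
    rw [cupProduct_map, e₁ i, e₂ i, corrAction_cross_signed hXt hXt h2 (rfl : 2 * p + 2 * d = 2 * p + 2 * d) h2,
      Even.neg_one_pow ⟨2 * p * p, by ring⟩, one_smul, cupProduct_degZero_right, hBapply, hlam]
  rw [Finset.sum_congr rfl fun i _ ↦ hterm i]
  have h := hrep W
  rw [map_sum] at h
  simpa only [map_smul] using h

/-! ## §3 The dichotomy is an equivalence -/

/-- **`(N_p)(t)` ALONE (`2p ≤ d`) ⟹ a decomposable class restricting to the identity of `I_t^{2p}`**: `(N_{d−p})(t)` follows from `(N_p)(t)` by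
part XV's hard-Lefschetz transfer (`algebraicInvariantClassesAt_compl_of_le`). [cite: Abdulali1994FamiliesAV, Theorem 5.5 (p. 1130)]
[cite: VoisinHodgeI2002, §6.2.3 Thm. 6.25] -/
theorem exists_decomposable_restrict_acts_as_id_of_algebraicInvariantClassesAt_of_le (t : ComplexPoints S) {p : ℕ} (hp : 2 * p ≤ d)
    (hNp : AlgebraicInvariantClassesAt hf t p) :
    ∃ γ ∈ 𝐃[𝒳, d], ∀ W : complexBetti 𝒳 (2 * p),
      𝐑[hf, t, 2 * p] (complexBetti.map (fiberι f t ⊗ₘ fiberι f t) (2 * d) γ) (𝐣[t, 2 * p] W) = 𝐣[t, 2 * p] W :=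
  exists_decomposable_restrict_acts_as_id_of_algebraicInvariantClassesAt hf t (q := d - p) (by omega) hNp
    (algebraicInvariantClassesAt_compl_of_le hf t (by omega) (by omega) hNp)

/-- **THE DICHOTOMY IS AN EQUIVALENCE: for `2p ≤ d`, a DECOMPOSABLE class of `𝒳 × 𝒳` restricting on `X_t × X_t` to the identity of
`j_t^* H^{2p}(𝒳)` exists IF AND ONLY IF `(N_p)(t)`** (⟹ part XLIV-d `algebraicInvariantClassesAt_of_decomposable_acts_as_id`; ⟸ §2). With part
XLIV-b §3 and §1: the member-side rows of the axis are EXACTLY the decomposable β-witnesses. [cite: Abdulali1994FamiliesAV, Conjecture 5.3 and Theorem 5.5]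
[cite: Kleiman1968AlgebraicCycles, §1.3 and Appendix to §2, Thm. 2A11] -/
theorem exists_decomposable_restrict_acts_as_id_iff_algebraicInvariantClassesAt (t : ComplexPoints S) {p : ℕ} (hp : 2 * p ≤ d) :
    (∃ γ ∈ 𝐃[𝒳, d], ∀ W : complexBetti 𝒳 (2 * p),
      𝐑[hf, t, 2 * p] (complexBetti.map (fiberι f t ⊗ₘ fiberι f t) (2 * d) γ) (𝐣[t, 2 * p] W) = 𝐣[t, 2 * p] W) ↔
      AlgebraicInvariantClassesAt hf t p :=
  ⟨fun ⟨_, hγ, hid⟩ ↦ algebraicInvariantClassesAt_of_decomposable_acts_as_id hf t hγ hid,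
    exists_decomposable_restrict_acts_as_id_of_algebraicInvariantClassesAt_of_le hf t hp⟩

/-- **Hence β at `t` in degree `2p ≤ d` from `(N_p)(t)`, through the restriction identity** (a decomposable witness is an algebraic class of
`𝒳 × 𝒳`, §1; part XLIV-b §3) — a second proof of part XIV-e's rung, now with the witness's RESTRICTION identified.
[cite: Abdulali1994FamiliesAV, Conjecture 5.3 and Theorem 5.5 (p. 1130)] [cite: Fulton1998, Thm. 6.2 (a) and §16.1] -/
theorem betaInverse_of_algebraicInvariantClassesAt_via_restriction (t : ComplexPoints S) {p : ℕ} (hp : 2 * p ≤ d)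
    (hNp : AlgebraicInvariantClassesAt hf t p) :
    ∃ T : complexBetti 𝒳 (2 * p + 2) →ₗ[ℂ] complexBetti 𝒳 (2 * p), IsAlgebraicCorrespondence (d + 1) (d + 1) 𝒳 𝒳 T ∧
      ∀ W, 𝐣[t, 2 * p] (T (complexGysin complexOrientationFamily (hf.isSmoothProjective_fiberOver t) hf.isSmoothProjective_total (fiberι f t)
        (deg_fiberGysin_aux (2 * p) d) (𝐣[t, 2 * p] W))) = 𝐣[t, 2 * p] W := by
  obtain ⟨γ, hγ, hid⟩ := exists_decomposable_restrict_acts_as_id_of_algebraicInvariantClassesAt_of_le hf t hp hNp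
  exact (betaInverse_iff_exists_restrict_acts_as_id hf t (by omega)).2 ⟨γ, decomposable_le_algebraicClasses hf hγ, hid⟩

end Summit.HodgeConjecture.HodgeConjecture.Ring2.AbelianAll

end
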